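import Literature.AlgebraicGeometry.Modules.PushforwardClosedImmersionFullyFaithful
import Literature.AlgebraicGeometry.Modules.LinearOverBase
import Literature.AlgebraicGeometry.Motives.ChernClassesProofs
import Mathlib.Algebra.Homology.ShortComplex.ExactFunctor
import Mathlib.CategoryTheory.Abelian.Exact
import HarnessLib

/-!
# The direct image along a closed immersion is exact on sheaves of modules

The Stacks Project, Tag 08KS (Modules, Lemma 17.13.4): for a closed immersion of ringed spaces
`i : Z → X`, "the functor `i_* : Mod(𝒪_Z) → Mod(𝒪_X)` is exact, fully faithful, with essential image
those `𝒪_X`-modules `𝓖` such that `𝓘𝓖 = 0`." The companion file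
`Modules/PushforwardClosedImmersionFullyFaithful.lean` proves the full faithfulness; this file proves
the EXACTNESS for a closed immersion of schemes `ι : Z → X` and Mathlib's direct image
`Scheme.Modules.pushforward ι` (`Γ(ι_*M, V) = Γ(M, ι⁻¹V)`):

* `pushforward_map_epi` — **`ι_*` preserves epimorphisms**: an epimorphism `φ : M → N` of
  `𝒪_Z`-modules is locally surjective on `Z` (tree `Scheme.Modules.exists_app_eq_of_epi`); a local
  lift over an open `U' ∋ z` of `Z` is a local lift of `ι_*φ` over the open `V ∩ extendOpen ι U' ∋ ι z`
  of `X` (`extendOpen ι U' = X ∖ ι(Z ∖ U')`, whose preimage is `U'`), and off the closed image of `ι`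
  the sections of `ι_*N` vanish; local surjectivity is epimorphy (Mathlib
  `TopCat.Sheaf.isLocallySurjective_iff_epi`);
* the instances `(pushforward ι).PreservesEpimorphisms`, `.PreservesHomology` and
  `PreservesFiniteColimits (pushforward ι)` (`ι_*` is a right adjoint, hence left exact, and an additive
  left exact functor preserving epimorphisms is exact — Mathlib
  `Functor.preservesHomology_of_preservesEpis_and_kernels`);
* `pushforward_map_globalScalar` — `ι_*` carries multiplication by `ι♯(a)` to multiplication by the
  global function `a` (`Modules/LinearOverBase.globalScalar`), and hence
  `pushforwardCokernelGlobalScalarIso : ι_*(P/ι♯(a)P) ≅ (ι_*P)/a(ι_*P)` compatibly with the two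
  cokernel projections (`map_cokernel_π_pushforwardCokernelGlobalScalarIso_hom`) — the form used for
  towers of modules on the thickenings of a scheme over a complete ring
  (`Morphisms/FormalFunctionsModule*`, `Motives/GrothendieckExistenceWitt`).

Everything is proved; no named facts.

## References

* The Stacks Project, Tag 08KS (Modules, Lemma 17.13.4); Tag 01QX–01QY (Morphisms, Section 29.4).
  [StacksProject]
* R. Hartshorne, *Algebraic Geometry*, GTM 52 (1977), II Ex. 1.19 (extension by zero along a closed
  subset is exact). [Hartshorne1977]
-/

noncomputable section

open CategoryTheory AlgebraicGeometry Limits TopologicalSpace Opposite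

universe u

namespace Literature.AlgebraicGeometry.Modules

open Literature.AlgebraicGeometry.Motives

variable {Z X : Scheme.{u}} (ι : Z ⟶ X)

/-! ## `ι_*` and multiplication by a global function -/

/-- **`ι_*(ι♯(a) · ) = a ·`**: the direct image of multiplication by `ι♯(a) ∈ Γ(Z, 𝒪_Z)` on an
`𝒪_Z`-module `P` is multiplication by the global function `a ∈ Γ(X, 𝒪_X)` on `ι_*P` (on
`Γ(V, ι_*P) = Γ(ι⁻¹V, P)` both are multiplication by `ι♯(a)|_{ι⁻¹V} = ι♯_V(a|_V)`). [folklore] -/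
theorem pushforward_map_globalScalar (P : Z.Modules) (a : Γ(X, ⊤)) :
    (Scheme.Modules.pushforward ι).map (globalScalar P (ι.appTop a)) =
      globalScalar ((Scheme.Modules.pushforward ι).obj P) a := by
  refine Scheme.Modules.hom_ext _ _ fun V => ?_
  ext s
  change (globalScalar P (ι.appTop a)).app (ι ⁻¹ᵁ V) s =
    (globalScalar ((Scheme.Modules.pushforward ι).obj P) a).app V s
  rw [globalScalar_app_apply, globalScalar_app_apply]
  change Z.presheaf.map (homOfLE (le_top : ι ⁻¹ᵁ V ≤ ⊤)).op (ι.appTop a) •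
      (show Γ(P, ι ⁻¹ᵁ V) from s) =
    ι.app V (X.presheaf.map (homOfLE (le_top : V ≤ ⊤)).op a) • (show Γ(P, ι ⁻¹ᵁ V) from s)
  congr 1
  have h' := congrArg (fun φ => φ.hom a) (ι.naturality (homOfLE (le_top : V ≤ ⊤)).op)
  exact h'.symm

/-- **`ι_*(P/ι♯(a)P) ≅ (ι_*P)/a(ι_*P)`** whenever `ι_*` preserves the cokernel (e.g. `ι` a closed
immersion, below): `ι_*` of the cokernel of multiplication by `ι♯(a)` is the cokernel of
multiplication by `a` on `ι_*P`. [folklore] -/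
def pushforwardCokernelGlobalScalarIso (P : Z.Modules) (a : Γ(X, ⊤))
    [PreservesColimit (parallelPair (globalScalar P (ι.appTop a)) 0)
      (Scheme.Modules.pushforward ι)] :
    (Scheme.Modules.pushforward ι).obj (cokernel (globalScalar P (ι.appTop a))) ≅
      cokernel (globalScalar ((Scheme.Modules.pushforward ι).obj P) a) :=
  PreservesCokernel.iso (Scheme.Modules.pushforward ι) (globalScalar P (ι.appTop a)) ≪≫
    cokernelIsoOfEq (pushforward_map_globalScalar ι P a)

/-- Compatibility of `pushforwardCokernelGlobalScalarIso` with the cokernel projections: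
`ι_*(π) ≫ ≅ = π`. [folklore] -/
@[reassoc]
theorem map_cokernel_π_pushforwardCokernelGlobalScalarIso_hom (P : Z.Modules) (a : Γ(X, ⊤))
    [PreservesColimit (parallelPair (globalScalar P (ι.appTop a)) 0)
      (Scheme.Modules.pushforward ι)] :
    (Scheme.Modules.pushforward ι).map (cokernel.π (globalScalar P (ι.appTop a))) ≫
        (pushforwardCokernelGlobalScalarIso ι P a).hom =
      cokernel.π (globalScalar ((Scheme.Modules.pushforward ι).obj P) a) := by
  rw [pushforwardCokernelGlobalScalarIso, Iso.trans_hom, PreservesCokernel.π_iso_hom_assoc,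
    π_comp_cokernelIsoOfEq_hom]

/-! ## `ι_*` preserves epimorphisms for a closed immersion -/

/-- Sections of an `𝒪_Z`-module over the preimage of an open missing the image of `ι` agree (the
preimage is empty). [folklore] -/
private theorem eq_of_preimage_eq_bot' (P : Z.Modules) {W : X.Opens} (hW : ∀ z : Z, ι.base z ∉ W)
    (s t : Γ(P, ι ⁻¹ᵁ W)) : s = t :=
  TopCat.Sheaf.eq_of_locally_eq' (⟨P.presheaf, P.isSheaf⟩ : TopCat.Sheaf Ab Z)
    (fun i : PEmpty.{u + 1} => (i.elim : Z.Opens)) (ι ⁻¹ᵁ W) (fun i => i.elim)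
    (fun z hz => (hW z hz).elim) s t fun i => i.elim

variable [IsClosedImmersion ι]

/-- **`ι_*` preserves epimorphisms for a closed immersion `ι : Z → X`**: `ι_*φ` is locally
surjective on `X` — a local lift of `t ∈ Γ(ι⁻¹V, N)` through the epimorphism `φ` over an open
`U' ∋ z` of `Z` lifts `t` through `ι_*φ` over `V ∩ extendOpen ι U' ∋ ι z` (preimage `U'`), and off
`ι(Z)` the target vanishes. [cite: StacksProject, Tag 08KS (Modules, Lemma 17.13.4)] -/
theorem pushforward_map_epi {M N : Z.Modules} (φ : M ⟶ N) [Epi φ] :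
    Epi ((Scheme.Modules.pushforward ι).map φ) := by
  have hls : TopCat.Presheaf.IsLocallySurjective
      ((Scheme.Modules.pushforward ι).map φ).mapPresheaf := by
    rw [TopCat.Presheaf.isLocallySurjective_iff]
    intro V t x hxV
    by_cases hx : x ∈ Set.range ι.base
    · obtain ⟨z, rfl⟩ := hx
      -- a local lift on `Z` over `U' ∋ z`, `U' ⊆ ι⁻¹V`
      obtain ⟨U', hU', hzU', s, hs⟩ :=
        Scheme.Modules.exists_app_eq_of_epi φ (ι ⁻¹ᵁ V) (show Γ(N, ι ⁻¹ᵁ V) from t) z hxV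
      have hle : ι ⁻¹ᵁ (V ⊓ extendOpen ι U') ≤ U' := fun z' hz' =>
        preimage_le_of_le_liftOpen ι (inf_le_right : V ⊓ extendOpen ι U' ≤ extendOpen ι U') hz'
      have hzE : ι.base z ∈ extendOpen ι U' := by
        rw [mem_liftOpen_iff]
        intro z' hz'
        rw [ι.isClosedEmbedding.injective hz']
        exact hzU'
      refine ⟨V ⊓ extendOpen ι U', inf_le_left, ⟨M.presheaf.map (homOfLE hle).op s, ?_⟩, hxV, hzE⟩
      change φ.app (ι ⁻¹ᵁ (V ⊓ extendOpen ι U')) (M.presheaf.map (homOfLE hle).op s) =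
        N.presheaf.map ((Opens.map ι.base).map (homOfLE (inf_le_left : V ⊓ extendOpen ι U' ≤ V))).op
          (show Γ(N, ι ⁻¹ᵁ V) from t)
      rw [Scheme.Modules.Hom.app_map_apply, hs]
      change (N.presheaf.map (homOfLE hU').op ≫ N.presheaf.map (homOfLE hle).op) t = _
      rw [← Functor.map_comp]
      rfl
    · -- off the closed image of `ι` the sections of `ι_*N` vanish
      refine ⟨V ⊓ ⟨(Set.range ι.base)ᶜ, ι.isClosedEmbedding.isClosed_range.isOpen_compl⟩,
        inf_le_left, ⟨0, ?_⟩, hxV, hx⟩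
      exact eq_of_preimage_eq_bot' ι N
        (fun z hz => (show ι.base z ∈ (V : Set X) ∩ (Set.range ι.base)ᶜ from hz).2 ⟨z, rfl⟩) _ _
  have h1 : Epi ((SheafOfModules.toSheaf X.ringCatSheaf).map ((Scheme.Modules.pushforward ι).map φ)) :=
    (TopCat.Sheaf.isLocallySurjective_iff_epi _).mp hls
  exact (SheafOfModules.toSheaf X.ringCatSheaf).epi_of_epi_map h1

/-- `ι_*` preserves epimorphisms (instance form). [cite: StacksProject, Tag 08KS (Modules, Lemma 17.13.4)] -/
instance pushforward_preservesEpimorphisms :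
    (Scheme.Modules.pushforward ι).PreservesEpimorphisms where
  preserves φ _ := pushforward_map_epi ι φ

/-- **`ι_*` is exact for a closed immersion**: it preserves homology (a right adjoint, so left exact,
and it preserves epimorphisms). [cite: StacksProject, Tag 08KS (Modules, Lemma 17.13.4)] -/
instance pushforward_preservesHomology : (Scheme.Modules.pushforward ι).PreservesHomology :=
  (Scheme.Modules.pushforward ι).preservesHomology_of_preservesEpis_and_kernels

/-- `ι_*` preserves finite colimits (in particular cokernels) for a closed immersion.
[cite: StacksProject, Tag 08KS (Modules, Lemma 17.13.4)] -/
instance pushforward_preservesFiniteColimits :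
    PreservesFiniteColimits (Scheme.Modules.pushforward ι) :=
  (Scheme.Modules.pushforward ι).preservesFiniteColimits_of_preservesHomology

/-- `ι_*` carries short exact sequences of `𝒪_Z`-modules to short exact sequences of `𝒪_X`-modules.
[cite: StacksProject, Tag 08KS (Modules, Lemma 17.13.4)] -/
theorem shortExact_map_pushforward {S : ShortComplex Z.Modules} (hS : S.ShortExact) :
    (S.map (Scheme.Modules.pushforward ι)).ShortExact :=
  hS.map_of_exact (Scheme.Modules.pushforward ι)

end Literature.AlgebraicGeometry.Modules

end
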